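import Summits.QuantumFields.YangMills.Theorems.BalabanUVNodesK2NamedJetsKKeyed
import Summits.QuantumFields.YangMills.Theorems.EndpointGivenBR13SepCoPH.Negative.Anchor13FalseOfTwoBaseHistories
import Summits.QuantumFields.BalabanUV.Gaps.BetaContFromD4Chain

/-!
# Crux K2⁷ `EndpointGivenBR13SepCoPH` (stmt-QuantumFields-20543), skeleton v6 — PRINT's ROAD ([II] (2.38) → [I] (5.10) → (1.22): the row-(D4) (190)-chain
# socket) AS A SUPPLIER ROAD OF THE REGISTERED XL TEXT 2ᴮ″ `RunRemAtSomeJets` BY NAME, in the RUN-WISE keying (hypothesis form; 0 `def`, 0 `sorry`)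

Cell pub-balaban (b2b), seat `b2b-balaban-beta-an4` (BINDER row D4 OWNER), gen 152.  Helper for crux K2⁷ = stmt-QuantumFields-20543 (`--supports … --as helper`);
count-neutral; NO skeleton is registered by this file.  Third supplier road for v6's 2ᴮ″ beside (i) idea-7's corner road `Theorems/BalabanUVNodesK2CornerRoad`
(N17 + anchor, p599976) and (ii) idea-5's convex fibre (crux workfile): (iii) the PRINTED road — the row-(D4) remainder chain with (1.7)-factorization and the
(190)-side data (`Beta.RemainderDecay190HoloChain.ChainTFac190H`, the row's socket since 2026-08-20; END `ChainTFac190H.abs_beta1_le`).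

WHAT IS HERE.
* §1 THE (190)-END IS POINTWISE PER HISTORY: the leaf list `PolLeavesTFac190H d M a c ℓ α₂ q` at ONE history already gives `|secondMoment (limKernel a) μ ν| ≤ ε₁·K_rem,L`
  (`abs_secondMoment_le_of_leaves190H`; the proof of `ChainTLocH.abs_beta1_le` read at one `(k, p)`).  Hence the row's socket can be posed on ANY set of histories.
* §2 THE RUN-WISE SOCKET (BN-F (N3)-compliant: no box-wide ∀k letter at a fixed level): leaves only at the in-window run prefixes `RGEqH n β gs ∧ Step.InInterval γ₀ n gs`
  ⟹ DEF-1's `RunConstRemainder β b (ε₁·K_rem,L) γ₀` (`runConstRemainder_of_runLeaves190H`); the box socket ⟹ `ConstRemainder` (`constRemainder_of_boxLeaves190H`); a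
  `ChainTFac190H` inhabitant IS the box socket at `b := S.β0` (`boxLeaves190H_of_chainTFac190H`); box ⟹ runs (`runLeaves190H_of_boxLeaves190H`).  Texts INLINE, no `def`.
* §3 IDENTIFICATION-FREE PRICING: a constant remainder relative to `b′` and a per-scale ANCHOR at `b` force `|b k − b′ k| ≤ s` at every scale and `ConstRemainder β b (2s) γ₀`
  (`abs_sub_le_of_constRemainder_scaleAnchor`, `constRemainder_of_constRemainder_scaleAnchor`): on print's road the identification clause «the chain's one-loop numbers ARE
  the `θ.cβ`-scaled named numbers» can be TRADED for the anchor at HALF the cap.  For a split, `b′ = S.β0 = β(0⃗)` whatever the split (`split_β0_eq_apply_zero` BY NAME), so at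
  the record the chain's reference numbers are always the zero-history values of the β of record (`abs_apply_zero_sub_le_of_remainderConst_scaleAnchor`).
* §4 AT THE RECORD `(F, κ, θ, hP)`: run socket + side conditions + `ε₁·K_rem,L ≤ cβ·stepBal 2 F.L` + `ScaleAnchor` + `SurvCont` ⟹ `RunRemAt F κ θ hP cβ`
  (`runRemAt_of_runLeaves190H`); `ChainTFac190H` + (C-pt) + identification ⟹ `RemAt` (`remAt_of_chainTFac190H`); `AtSlopeCont` + identification ⟹ `RemAt`
  (`remAt_of_atSlopeCont`); `AtSlopeCont` + anchor at half cap ⟹ `RemAt` (`remAt_of_atSlopeCont_scaleAnchor`); each ⟹ `RunRemAt` by DEF-1's `runRemAt_of_remAt`.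
* §5 v6 KEYING: the ∀θ print-road text (INLINE) ⟹ v6's registered 2ᴮ″ text `RunRemAtSomeJets` INLINE (`runRemAtSomeJetsK_of_runChain190K`), and with v6's 1ᴬ
  `D1AtAnchoredJets` the crux decl BY NAME through DEF-1's `EndpointGivenBR13SepCoPH_of_anchorKeyedK_runShadowingJetsK` (`EndpointGivenBR13SepCoPH_of_d1AnchoredK_runChain190K`).
  (B) ∕ the window ∕ the unity guard are UNUSED on this road (consistent with idea-4's F3 «the typed (B) is β-silent»).

HONEST FRAMING.  Implications between displayed HYPOTHESIS SHAPES and elementary real bookkeeping; NOTHING of Bałaban's analysis is asserted or discharged: the leaves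
at the record's run histories (= NODE O's small-field step objects as terms, ownerless ∕ FROZEN), the side conditions with the cap (numerics N1–N3), the anchor (the
identification) and the survivor continuity are hypotheses inhabited at no θ here (instance 0∕1); (D4) NOT discharged; K2⁷ ∕ its two registered stubs NOT proved (v6:
2 registered, 0 closed); counts unmoved; [Balaban1987RG1] Thm 2 + (0.31) p. 259 is UNPROVED IN PRINT; route R4 closes the CONDITIONAL finite-𝕋⁴ rung `BalabanLadder.UV`
only — NOT the continuum limit, NOT ℝ⁴, NOT OS, NOT the Yang–Mills mass gap, NOT Clay.  No `def`, no `instance`, no `notation`, no `axiom`.  Sources (context only;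
nothing printed is used as a hypothesis): [I] = [Balaban1987RG1] CMP **109** (1987): Thm 2 p. 259 (first sentence), Thm 3 p. 264, (1.20)–(1.22) p. 264, (1.7) p. 261,
(2.12)–(2.14) p. 268, (4.4) p. 281, (5.10) p. 293; [II] = [Balaban1988RG2Cluster] CMP **116** (1988): Lemma 3 (2.38) p. 20, (2.41) p. 21; [15] = [Balaban1985Variational]
CMP **102** (1985): (190) p. 308.
-/

noncomputable section

namespace Summit.QuantumFields.YangMills.Theorems.BalabanUVNodesK2RunRemAtOfChain190

open Literature.MathematicalPhysics.QuantumFieldTheory.Balaban1983to89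
open Literature.MathematicalPhysics.QuantumFieldTheory.Balaban1983to89.FlowStep
open Literature.MathematicalPhysics.QuantumFieldTheory.Balaban1983to89.B12Beta (HistBox OneLoopSplit)
open Literature.MathematicalPhysics.QuantumFieldTheory.Balaban1983to89.B13ScaleTransfer (Pt)
open Literature.MathematicalPhysics.QuantumFieldTheory.Balaban1983to89.DagBinding (EndpointExistence)
open Literature.MathematicalPhysics.QuantumFieldTheory.Balaban1983to89.T4Continuum (T4Family)
open Literature.MathematicalPhysics.QuantumFieldTheory.Balaban1983to89.Beta.Drift (OneLoopDrift)
open Literature.MathematicalPhysics.QuantumFieldTheory.Balaban1983to89.Beta.RemainderChain (RemainderConst abs_secondMoment_le_linear)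
open Literature.MathematicalPhysics.QuantumFieldTheory.Balaban1983to89.Beta.RemainderChainLattice
open Literature.MathematicalPhysics.QuantumFieldTheory.Balaban1983to89.Beta.RemainderLimitTorus (LDom limKernel)
open Literature.MathematicalPhysics.QuantumFieldTheory.Balaban1983to89.Beta.RemainderLimitTorusHolo
open Literature.MathematicalPhysics.QuantumFieldTheory.Balaban1983to89.Beta.RemainderLocalityHolo
open Literature.MathematicalPhysics.QuantumFieldTheory.Balaban1983to89.Beta.RemainderDecay190
open Literature.MathematicalPhysics.QuantumFieldTheory.Balaban1983to89.Beta.RemainderDecay190HoloChain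
open Summit.QuantumFields.BalabanUV.Gaps.BetaContFromD4Chain
  (AtSlopeCont CPt betaContH_of_chainTFac190H remainderConst_of_atSlopeCont betaContH_of_atSlopeCont)
open Summit.QuantumFields.YangMills.Theorems.BalabanUVNodesK2JsOfRecord (StepColourData beta0OfJs)
open Summit.QuantumFields.YangMills.Theorems.BalabanUVNodesK2NamedJetsRemAt (RemAt ConstRemainder ScaleAnchor)
open Summit.QuantumFields.YangMills.Theorems.BalabanUVNodesK2NamedJetsRunRemAt
  (RunRemAt RunConstRemainder SurvCont runRemAt_of_remAt runConstRemainder_of_constRemainder)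
open Summit.QuantumFields.YangMills.Theorems.BalabanUVNodesK2Line1PrimeRemainderPrice (constRemainder_of_remainderConst)
open Summit.QuantumFields.YangMills.Theorems.BalabanUVNodesK2NamedJetsKKeyed (EndpointGivenBR13SepCoPH_of_anchorKeyedK_runShadowingJetsK)
open Summit.QuantumFields.YangMills.Theorems.EndpointGivenBR13SepCoPH.Negative.Anchor13FalseOfTwoBaseHistories (split_β0_eq_apply_zero)

/-! ## §1 The (190)-END is pointwise per history -/

section Pointwise

variable {d M : ℕ} [NeZero M] {a : LDom d → Pt d → ℝ} {c : B13.Consts} {ℓ α₂ : ℝ} {q : Consts190}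

/-- **THE ROW-(D4) END AT ONE HISTORY, holomorphic currency**: the leaf list of the (190)-chain at a single remainder kernel `a` — torus activities with the
[II] (2.38) bound, (1.7)-factorization, the (190)-side data, `K → ∞` exhaustion — gives the (5.10)-decay of the limit kernel and hence
`|secondMoment (limKernel a) μ ν| ≤ ε₁ · K_rem,L(d, M, c, α₂, Cκ̄_Bcm)`, the SAME coefficient as `ChainTFac190H.abs_beta1_le` (whose proof this is, read at one
`(k, p)`).  Nothing is uniform in anything here: ONE history, ONE kernel. [cite: Balaban1988RG2Cluster, Lemma 3 (2.38) p.20; Balaban1987RG1, (5.10) p.293 and (1.22) p.264; Balaban1985Variational, (190) p.308] -/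
theorem abs_secondMoment_le_of_leaves190H (Lv : PolLeavesTFac190H d M a c ℓ α₂ q) (hC : CondsL d c ℓ) (h22 : c.R22gen ℓ)
    (hq : q.Valid c.δ₀) (hs : SignsL c α₂ q.B₃) (hd : 0 < d) (μ ν : Fin d) :
    |B12Beta.secondMoment (fun _ _ => limKernel a) μ ν| ≤ c.ε₁ * remCoeffL d M c α₂ q.B₃ := by
  have hδ₁ : 0 < deltaL d M c := deltaL_pos hC hs.δ₀_pos hd (Nat.pos_of_neZero M)
  have hdec := ((Lv.toPolLeavesTFacH hq).toPolLeavesTLocH hs.α₂_pos).decay510 hC h22 hs hd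
  rw [eps1_mul_remCoeffL]
  exact abs_secondMoment_le_linear hδ₁ hdec

/-- The same from the ANALYTIC-currency leaf list `RemainderDecay190.PolLeavesTFac190` (`PolLeavesTFac190H.ofAnalytic`). [folklore] -/
theorem abs_secondMoment_le_of_leaves190 (Lv : PolLeavesTFac190 d M a c ℓ α₂ q) (hC : CondsL d c ℓ) (h22 : c.R22gen ℓ)
    (hq : q.Valid c.δ₀) (hs : SignsL c α₂ q.B₃) (hd : 0 < d) (μ ν : Fin d) :
    |B12Beta.secondMoment (fun _ _ => limKernel a) μ ν| ≤ c.ε₁ * remCoeffL d M c α₂ q.B₃ :=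
  abs_secondMoment_le_of_leaves190H (PolLeavesTFac190H.ofAnalytic Lv) hC h22 hq hs hd μ ν

end Pointwise

/-! ## §2 The run-wise socket (texts inline) ⟹ DEF-1's `RunConstRemainder`; the box socket ⟹ `ConstRemainder`; the chain IS the box socket -/

section Sockets

variable {d M : ℕ} [NeZero M] {μ ν : Fin d} {c : B13.Consts} {ℓ α₂ : ℝ} {q : Consts190} {β : HBeta} {b : ℕ → ℝ} {γ₀ : ℝ}

/-- **PRINT's ROAD, RUN EDITION ⟹ `RunConstRemainder`.**  HYPOTHESIS SHAPE (inline): at every prefix `(g_0,…,g_k)`, `k ≤ n`, of every solution of (0.20) up to `n`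
staying in `]0, γ₀]`, the remainder `β_{k+1}(g_0,…,g_k) − b_k` is the (1.22) second moment of the limit kernel of SOME remainder-activity family carrying the
(190)-leaf list — print's road posed where [I] Thm 3 p. 264 reads β (along the runs), with NO box-wide ∀k letter.  Conclusion: DEF-1's run-wise constant
remainder with `r = ε₁·K_rem,L`.  Discharges nothing: the leaves at the record's run histories are NODE O's objects (instance 0∕1).
[cite: Balaban1987RG1, Thm 3 p.264, (1.20)-(1.22) p.264 and (5.10) p.293; Balaban1988RG2Cluster, Lemma 3 (2.38) p.20] -/
theorem runConstRemainder_of_runLeaves190H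
    (hrun : ∀ (n : ℕ) (gs : ℕ → ℝ), RGEqH n β gs → Step.InInterval γ₀ n gs → ∀ k, k ≤ n →
      ∃ a : LDom d → Pt d → ℝ, β k (prefixOf gs k) - b k = B12Beta.secondMoment (fun _ _ => limKernel a) μ ν ∧
        Nonempty (PolLeavesTFac190H d M a c ℓ α₂ q))
    (hC : CondsL d c ℓ) (h22 : c.R22gen ℓ) (hq : q.Valid c.δ₀) (hs : SignsL c α₂ q.B₃) (hd : 0 < d) :
    RunConstRemainder β b (c.ε₁ * remCoeffL d M c α₂ q.B₃) γ₀ := fun n gs hrg hI k hk => by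
  obtain ⟨a, hrep, ⟨Lv⟩⟩ := hrun n gs hrg hI k hk
  rw [hrep]
  exact abs_secondMoment_le_of_leaves190H Lv hC h22 hq hs hd μ ν

/-- **PRINT's ROAD, BOX EDITION ⟹ `ConstRemainder`** (the row's socket of record, split-free: leaves at every history of `]0, γ₀]^{k+1}`, every `k`). [cite: Balaban1987RG1, (1.22) p.264 and (5.10) p.293; Balaban1988RG2Cluster, (2.38) p.20] -/
theorem constRemainder_of_boxLeaves190H
    (hbox : ∀ (k : ℕ) (p : Fin (k + 1) → ℝ), p ∈ HistBox γ₀ k →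
      ∃ a : LDom d → Pt d → ℝ, β k p - b k = B12Beta.secondMoment (fun _ _ => limKernel a) μ ν ∧
        Nonempty (PolLeavesTFac190H d M a c ℓ α₂ q))
    (hC : CondsL d c ℓ) (h22 : c.R22gen ℓ) (hq : q.Valid c.δ₀) (hs : SignsL c α₂ q.B₃) (hd : 0 < d) :
    ConstRemainder β b (c.ε₁ * remCoeffL d M c α₂ q.B₃) γ₀ := fun k p hp => by
  obtain ⟨a, hrep, ⟨Lv⟩⟩ := hbox k p hp
  rw [hrep]
  exact abs_secondMoment_le_of_leaves190H Lv hC h22 hq hs hd μ ν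

/-- BOX ⟹ RUNS for the socket itself: in-window run prefixes lie in `HistBox γ₀` (the pattern of DEF-1's `runConstRemainder_of_constRemainder`). [folklore] -/
theorem runLeaves190H_of_boxLeaves190H
    (hbox : ∀ (k : ℕ) (p : Fin (k + 1) → ℝ), p ∈ HistBox γ₀ k →
      ∃ a : LDom d → Pt d → ℝ, β k p - b k = B12Beta.secondMoment (fun _ _ => limKernel a) μ ν ∧
        Nonempty (PolLeavesTFac190H d M a c ℓ α₂ q)) :
    ∀ (n : ℕ) (gs : ℕ → ℝ), RGEqH n β gs → Step.InInterval γ₀ n gs → ∀ k, k ≤ n →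
      ∃ a : LDom d → Pt d → ℝ, β k (prefixOf gs k) - b k = B12Beta.secondMoment (fun _ _ => limKernel a) μ ν ∧
        Nonempty (PolLeavesTFac190H d M a c ℓ α₂ q) :=
  fun _n gs _ hI k hk => hbox k (prefixOf gs k) fun i => hI i ((Nat.lt_succ_iff.mp i.isLt).trans hk)

/-- **THE ROW's SOCKET OF RECORD IS THE BOX SOCKET at `b := S.β0`**: an inhabitant `R : ChainTFac190H d M μ ν S γ₀ c ℓ α₂ q` supplies, at every history of the box,
the kernel `R.A1 k p` with `β_{k+1}(p) − β⁰_{k+1} = β¹_{k+1}(p) = secondMoment (limKernel (R.A1 k p)) μ ν` and its leaves. [folklore] -/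
theorem boxLeaves190H_of_chainTFac190H {S : OneLoopSplit β} (R : ChainTFac190H d M μ ν S γ₀ c ℓ α₂ q) :
    ∀ (k : ℕ) (p : Fin (k + 1) → ℝ), p ∈ HistBox γ₀ k →
      ∃ a : LDom d → Pt d → ℝ, β k p - S.β0 k = B12Beta.secondMoment (fun _ _ => limKernel a) μ ν ∧
        Nonempty (PolLeavesTFac190H d M a c ℓ α₂ q) :=
  fun k p hp => ⟨R.A1 k p, by rw [S.split k p, add_sub_cancel_left]; exact R.beta1_eq k p hp, ⟨R.leaves k p hp⟩⟩

/-- … hence the chain's END in DEF-1's split-free currency: `ConstRemainder β S.β0 (ε₁·K_rem,L) γ₀` (= an4's `constRemainder_of_remainderConst ∘ abs_beta1_le`, re-derived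
through the box socket as a consistency check). [cite: Balaban1987RG1, (1.22) p.264 and (5.10) p.293] -/
theorem constRemainder_of_chainTFac190H {S : OneLoopSplit β} (R : ChainTFac190H d M μ ν S γ₀ c ℓ α₂ q) (hC : CondsL d c ℓ)
    (h22 : c.R22gen ℓ) (hq : q.Valid c.δ₀) (hs : SignsL c α₂ q.B₃) (hd : 0 < d) :
    ConstRemainder β S.β0 (c.ε₁ * remCoeffL d M c α₂ q.B₃) γ₀ :=
  constRemainder_of_boxLeaves190H (boxLeaves190H_of_chainTFac190H R) hC h22 hq hs hd

/-- … and its RUN restriction `RunConstRemainder β S.β0 (ε₁·K_rem,L) γ₀`. [folklore] -/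
theorem runConstRemainder_of_chainTFac190H {S : OneLoopSplit β} (R : ChainTFac190H d M μ ν S γ₀ c ℓ α₂ q) (hC : CondsL d c ℓ)
    (h22 : c.R22gen ℓ) (hq : q.Valid c.δ₀) (hs : SignsL c α₂ q.B₃) (hd : 0 < d) :
    RunConstRemainder β S.β0 (c.ε₁ * remCoeffL d M c α₂ q.B₃) γ₀ :=
  runConstRemainder_of_constRemainder (constRemainder_of_chainTFac190H R hC h22 hq hs hd)

end Sockets

/-! ## §3 Identification-free pricing: a constant remainder relative to `b′` and an anchor at `b` pin `b` to within the remainder of `b′` -/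

section AnchorPrice

variable {β : HBeta} {b b' : ℕ → ℝ} {s γ₀ : ℝ}

/-- **★ THE ANCHOR PINS THE NAMED NUMBERS TO WITHIN `s` OF ANY CONSTANT-REMAINDER REFERENCE**: `ConstRemainder β b′ s γ₀` (`0 < γ₀`) and `ScaleAnchor β b` give
`|b k − b′ k| ≤ s` at every scale (evaluate both at a small constant history and let the anchoring tolerance go to zero). [folklore] -/
theorem abs_sub_le_of_constRemainder_scaleAnchor (hrem : ConstRemainder β b' s γ₀) (hγ₀ : 0 < γ₀) (hA : ScaleAnchor β b) (k : ℕ) :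
    |b k - b' k| ≤ s := by
  refine le_of_forall_pos_le_add fun ε hε => ?_
  obtain ⟨γ, hγ, h⟩ := hA k ε hε
  have h1 : |β k (fun _ => min γ γ₀) - b k| ≤ ε := h (fun _ => min γ γ₀) fun _ => ⟨lt_min hγ hγ₀, min_le_left _ _⟩
  have h2 : |β k (fun _ => min γ γ₀) - b' k| ≤ s := hrem k (fun _ => min γ γ₀) fun _ => ⟨lt_min hγ hγ₀, min_le_right _ _⟩
  calc |b k - b' k| = |(β k (fun _ => min γ γ₀) - b' k) - (β k (fun _ => min γ γ₀) - b k)| := by ring_nf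
    _ ≤ |β k (fun _ => min γ γ₀) - b' k| + |β k (fun _ => min γ γ₀) - b k| := abs_sub _ _
    _ ≤ s + ε := add_le_add h2 h1

/-- **★ … SO THE IDENTIFICATION CLAUSE CAN BE TRADED FOR THE ANCHOR AT HALF THE CAP**: `ConstRemainder β b′ s γ₀ ∧ ScaleAnchor β b ⟹ ConstRemainder β b (2s) γ₀`. [folklore] -/
theorem constRemainder_of_constRemainder_scaleAnchor (hrem : ConstRemainder β b' s γ₀) (hγ₀ : 0 < γ₀) (hA : ScaleAnchor β b) :
    ConstRemainder β b (2 * s) γ₀ := fun k p hp => by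
  have h1 := hrem k p hp
  have h2 := abs_sub_le_of_constRemainder_scaleAnchor hrem hγ₀ hA k
  calc |β k p - b k| = |(β k p - b' k) + (b' k - b k)| := by ring_nf
    _ ≤ |β k p - b' k| + |b' k - b k| := abs_add_le _ _
    _ ≤ s + s := add_le_add h1 (by rw [abs_sub_comm]; exact h2)
    _ = 2 * s := by ring

/-- For a one-loop split the reference numbers are the ZERO-HISTORY VALUES of `β`, whatever the split (`split_β0_eq_apply_zero` BY NAME): a constant remainder
`RemainderConst S γ₀ s` of ANY split plus an anchor at `b` force `|β_{k+1}(0⃗) − b_k| ≤ s` at every scale — at the Stage-13 record, where `β(0⃗)` is the base-history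
one-loop number of record, print's road at slope `s` ties those numbers to the anchoring named numbers within `s`. [cite: Balaban1987RG1, (2.12)-(2.14) p.268 and (1.22) p.264] -/
theorem abs_apply_zero_sub_le_of_remainderConst_scaleAnchor (S : OneLoopSplit β) (hrem : RemainderConst S γ₀ s) (hγ₀ : 0 < γ₀)
    (hA : ScaleAnchor β b) (k : ℕ) : |β k (fun _ => 0) - b k| ≤ s := by
  rw [← split_β0_eq_apply_zero S k, abs_sub_comm]
  exact abs_sub_le_of_constRemainder_scaleAnchor (constRemainder_of_remainderConst S hrem) hγ₀ hA k

/-- … and `ConstRemainder β b (2s) γ₀` relative to the anchoring numbers, from ANY split's `RemainderConst S γ₀ s`. [folklore] -/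
theorem constRemainder_of_remainderConst_scaleAnchor (S : OneLoopSplit β) (hrem : RemainderConst S γ₀ s) (hγ₀ : 0 < γ₀)
    (hA : ScaleAnchor β b) : ConstRemainder β b (2 * s) γ₀ :=
  constRemainder_of_constRemainder_scaleAnchor (constRemainder_of_remainderConst S hrem) hγ₀ hA

end AnchorPrice

/-! ## §4 At the Stage-13 record: print's road ⟹ DEF-1's letters `RunRemAt` ∕ `RemAt` -/

section Record

variable (F : T4Family) (κ : StepColourData) (θ : Node00.Stage13HParams F 2) (hP : θ.Provisos₁₃SepCoPH F 2)
variable {M : ℕ} [NeZero M] {μ ν : Fin 4} {c : B13.Consts} {ℓ α₂ : ℝ} {q : Consts190} {γ₀ s cβ : ℝ}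

/-- **★★ PRINT's ROAD, RUN EDITION, AT THE RECORD ⟹ `RunRemAt F κ θ hP cβ`**: the (190)-leaves at every in-window run prefix of the datum's β relative to the `cβ`-scaled
named numbers, the side conditions, the cap `ε₁·K_rem,L ≤ cβ·stepBal 2 F.L` (numerics N1–N3), the per-scale ANCHOR (identification clause) and survivor continuity
(C) — all hypotheses — give DEF-1's run letter at scale `cβ` (the stub text 2ᴮ″ reads it at `cβ := θ.cβ`).  Supplier road (iii) for v6's `stub_runRemNamedJets13`,
modulo NODE O.  (B) ∕ window ∕ unity unused. [cite: Balaban1987RG1, Thm 3 p.264, (1.20)-(1.22) p.264, (2.12)-(2.14) p.268 and (5.10) p.293; Balaban1988RG2Cluster, Lemma 3 (2.38) p.20 and (2.41) p.21] -/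
theorem runRemAt_of_runLeaves190H
    (hrun : ∀ (n : ℕ) (gs : ℕ → ℝ), RGEqH n (Node00.datumOfRecord₁₃SepCoPH F 2 θ hP).βfun gs → Step.InInterval γ₀ n gs → ∀ k, k ≤ n →
      ∃ a : LDom 4 → Pt 4 → ℝ, (Node00.datumOfRecord₁₃SepCoPH F 2 θ hP).βfun k (prefixOf gs k) - cβ * beta0OfJs F κ k =
        B12Beta.secondMoment (fun _ _ => limKernel a) μ ν ∧ Nonempty (PolLeavesTFac190H 4 M a c ℓ α₂ q))
    (hC : CondsL 4 c ℓ) (h22 : c.R22gen ℓ) (hq : q.Valid c.δ₀) (hs : SignsL c α₂ q.B₃) (hγ₀ : 0 < γ₀) (hγθ : γ₀ ≤ θ.γ)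
    (hcap : c.ε₁ * remCoeffL 4 M c α₂ q.B₃ ≤ cβ * B12Normalization.stepBal 2 F.L)
    (hA : ScaleAnchor (Node00.datumOfRecord₁₃SepCoPH F 2 θ hP).βfun (fun k => cβ * beta0OfJs F κ k))
    (hcont : SurvCont (Node00.datumOfRecord₁₃SepCoPH F 2 θ hP).βfun γ₀) : RunRemAt F κ θ hP cβ :=
  ⟨γ₀, c.ε₁ * remCoeffL 4 M c α₂ q.B₃, hγ₀, hγθ, hcap, runConstRemainder_of_runLeaves190H hrun hC h22 hq hs (by norm_num), hA, hcont⟩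

/-- **★ PRINT's ROAD, BOX EDITION (the row's socket of record) ⟹ `RemAt F κ θ hP cβ`**: ONE inhabitant `R : ChainTFac190H 4 M μ ν Sβ γ₀ c ℓ α₂ q` for a split `Sβ` of the
datum's β WHOSE ONE-LOOP NUMBERS ARE the `cβ`-scaled named numbers (identification `hid`), with (C-pt), the side conditions, the cap and the anchor ⟹ DEF-1's box letter
((C) on the box DERIVED: `Gaps.BetaContFromD4Chain.betaContH_of_chainTFac190H`). [cite: Balaban1987RG1, (1.20)-(1.22) p.264, (4.4) p.281 and (5.10) p.293; Balaban1988RG2Cluster, Lemma 3 (2.38) p.20] -/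
theorem remAt_of_chainTFac190H (Sβ : OneLoopSplit (Node00.datumOfRecord₁₃SepCoPH F 2 θ hP).βfun)
    (R : ChainTFac190H 4 M μ ν Sβ γ₀ c ℓ α₂ q) (hcpt : CPt R) (hC : CondsL 4 c ℓ) (h22 : c.R22gen ℓ) (hq : q.Valid c.δ₀)
    (hs : SignsL c α₂ q.B₃) (hγ₀ : 0 < γ₀) (hγθ : γ₀ ≤ θ.γ) (hcap : c.ε₁ * remCoeffL 4 M c α₂ q.B₃ ≤ cβ * B12Normalization.stepBal 2 F.L)
    (hid : ∀ k, Sβ.β0 k = cβ * beta0OfJs F κ k)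
    (hA : ScaleAnchor (Node00.datumOfRecord₁₃SepCoPH F 2 θ hP).βfun (fun k => cβ * beta0OfJs F κ k)) : RemAt F κ θ hP cβ := by
  refine ⟨γ₀, c.ε₁ * remCoeffL 4 M c α₂ q.B₃, hγ₀, hγθ, hcap, fun k p hp => ?_, hA,
    betaContH_of_chainTFac190H R hC h22 hq hs (by norm_num) hcpt⟩
  show |(Node00.datumOfRecord₁₃SepCoPH F 2 θ hP).βfun k p - cβ * beta0OfJs F κ k| ≤ _
  rw [← hid k]
  exact constRemainder_of_chainTFac190H R hC h22 hq hs (by norm_num) k p hp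

/-- **★ THE RESIDUE `AtSlopeCont Sβ γ₀ s` (rows (D4) ∧ B4 of record, cell pub-balaban-gaps) + identification ⟹ `RemAt F κ θ hP cβ`** whenever `s ≤ cβ·stepBal 2 F.L`
and `0 < γ₀ ≤ θ.γ` (`remainderConst_of_atSlopeCont`, `betaContH_of_atSlopeCont` BY NAME). [cite: Balaban1987RG1, (1.20)-(1.22) p.264 and (5.10) p.293; Balaban1988RG2Cluster, Lemma 3 (2.38) p.20] -/
theorem remAt_of_atSlopeCont (Sβ : OneLoopSplit (Node00.datumOfRecord₁₃SepCoPH F 2 θ hP).βfun) (h : AtSlopeCont Sβ γ₀ s)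
    (hγ₀ : 0 < γ₀) (hγθ : γ₀ ≤ θ.γ) (hcap : s ≤ cβ * B12Normalization.stepBal 2 F.L) (hid : ∀ k, Sβ.β0 k = cβ * beta0OfJs F κ k)
    (hA : ScaleAnchor (Node00.datumOfRecord₁₃SepCoPH F 2 θ hP).βfun (fun k => cβ * beta0OfJs F κ k)) : RemAt F κ θ hP cβ := by
  refine ⟨γ₀, s, hγ₀, hγθ, hcap, fun k p hp => ?_, hA, betaContH_of_atSlopeCont h⟩
  show |(Node00.datumOfRecord₁₃SepCoPH F 2 θ hP).βfun k p - cβ * beta0OfJs F κ k| ≤ _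
  rw [← hid k]
  exact constRemainder_of_remainderConst Sβ (remainderConst_of_atSlopeCont h) k p hp

/-- **★★ THE IDENTIFICATION-FREE EDITION**: `AtSlopeCont Sβ γ₀ s` for ANY split of the datum's β + the ANCHOR at the `cβ`-scaled named numbers ⟹ `RemAt F κ θ hP cβ` at
HALF THE CAP (`2s ≤ cβ·stepBal 2 F.L`) — no clause naming the split's one-loop numbers (§3). [cite: Balaban1987RG1, (1.20)-(1.22) p.264, (2.12)-(2.14) p.268 and (5.10) p.293] -/
theorem remAt_of_atSlopeCont_scaleAnchor (Sβ : OneLoopSplit (Node00.datumOfRecord₁₃SepCoPH F 2 θ hP).βfun) (h : AtSlopeCont Sβ γ₀ s)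
    (hγ₀ : 0 < γ₀) (hγθ : γ₀ ≤ θ.γ) (hcap : 2 * s ≤ cβ * B12Normalization.stepBal 2 F.L)
    (hA : ScaleAnchor (Node00.datumOfRecord₁₃SepCoPH F 2 θ hP).βfun (fun k => cβ * beta0OfJs F κ k)) : RemAt F κ θ hP cβ :=
  ⟨γ₀, 2 * s, hγ₀, hγθ, hcap, constRemainder_of_remainderConst_scaleAnchor Sβ (remainderConst_of_atSlopeCont h) hγ₀ hA, hA,
    betaContH_of_atSlopeCont h⟩

/-- … and the identification-free edition straight from a chain inhabitant + (C-pt) (cap `2·ε₁·K_rem,L ≤ cβ·stepBal 2 F.L`). [cite: Balaban1987RG1, (1.22) p.264 and (5.10) p.293; Balaban1988RG2Cluster, (2.38) p.20] -/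
theorem remAt_of_chainTFac190H_scaleAnchor (Sβ : OneLoopSplit (Node00.datumOfRecord₁₃SepCoPH F 2 θ hP).βfun)
    (R : ChainTFac190H 4 M μ ν Sβ γ₀ c ℓ α₂ q) (hcpt : CPt R) (hC : CondsL 4 c ℓ) (h22 : c.R22gen ℓ) (hq : q.Valid c.δ₀)
    (hs : SignsL c α₂ q.B₃) (hγ₀ : 0 < γ₀) (hγθ : γ₀ ≤ θ.γ) (hcap : 2 * (c.ε₁ * remCoeffL 4 M c α₂ q.B₃) ≤ cβ * B12Normalization.stepBal 2 F.L)
    (hA : ScaleAnchor (Node00.datumOfRecord₁₃SepCoPH F 2 θ hP).βfun (fun k => cβ * beta0OfJs F κ k)) : RemAt F κ θ hP cβ :=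
  ⟨γ₀, 2 * (c.ε₁ * remCoeffL 4 M c α₂ q.B₃), hγ₀, hγθ, hcap,
    constRemainder_of_constRemainder_scaleAnchor (constRemainder_of_chainTFac190H R hC h22 hq hs (by norm_num)) hγ₀ hA, hA,
    betaContH_of_chainTFac190H R hC h22 hq hs (by norm_num) hcpt⟩

/-- Each box edition ⟹ the RUN letter (DEF-1's `runRemAt_of_remAt` BY NAME); e.g. the residue + anchor at half cap ⟹ `RunRemAt F κ θ hP cβ`. [folklore] -/
theorem runRemAt_of_atSlopeCont_scaleAnchor (Sβ : OneLoopSplit (Node00.datumOfRecord₁₃SepCoPH F 2 θ hP).βfun) (h : AtSlopeCont Sβ γ₀ s)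
    (hγ₀ : 0 < γ₀) (hγθ : γ₀ ≤ θ.γ) (hcap : 2 * s ≤ cβ * B12Normalization.stepBal 2 F.L)
    (hA : ScaleAnchor (Node00.datumOfRecord₁₃SepCoPH F 2 θ hP).βfun (fun k => cβ * beta0OfJs F κ k)) : RunRemAt F κ θ hP cβ :=
  runRemAt_of_remAt F κ θ hP (remAt_of_atSlopeCont_scaleAnchor F κ θ hP Sβ h hγ₀ hγθ hcap hA)

/-- PRICE DISPLAYED at the record: print's road at slope `s` (ANY split's `RemainderConst`, e.g. from `AtSlopeCont`) + the anchor ⟹ the datum's ZERO-HISTORY values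
`β_{k+1}(0⃗)` (the base-history one-loop numbers of record) lie within `s` of the `cβ`-scaled named numbers, every `k`. [cite: Balaban1987RG1, (2.12)-(2.14) p.268 and (1.22) p.264] -/
theorem abs_apply_zero_sub_named_le_of_atSlopeCont_scaleAnchor (Sβ : OneLoopSplit (Node00.datumOfRecord₁₃SepCoPH F 2 θ hP).βfun)
    (h : AtSlopeCont Sβ γ₀ s) (hγ₀ : 0 < γ₀)
    (hA : ScaleAnchor (Node00.datumOfRecord₁₃SepCoPH F 2 θ hP).βfun (fun k => cβ * beta0OfJs F κ k)) (k : ℕ) :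
    |(Node00.datumOfRecord₁₃SepCoPH F 2 θ hP).βfun k (fun _ => 0) - cβ * beta0OfJs F κ k| ≤ s :=
  abs_apply_zero_sub_le_of_remainderConst_scaleAnchor Sβ (remainderConst_of_atSlopeCont h) hγ₀ hA k

end Record

/-! ## §5 v6 keying: the ∀θ print-road text ⟹ the registered 2ᴮ″ text, and with 1ᴬ the crux decl BY NAME -/

section Keyed

/-- **★★ PRINT's ROAD AS A SUPPLIER OF v6's REGISTERED XL TEXT 2ᴮ″ `RunRemAtSomeJets`** (both texts INLINE at v6's full-prefix keying, `Window13` unfolded as the crux decl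
spells it): if at every tuple carrying the crux's hypotheses SOME colour datum κ and SOME chain data give the run-wise (190)-socket relative to the `θ.cβ`-scaled named
numbers with the side conditions, the cap, the anchor and survivor continuity, then v6's 2ᴮ″ holds — `runRemAt_of_runLeaves190H` pointwise.  CONDITIONAL; discharges nothing.
[cite: Balaban1987RG1, Thm 3 p.264, (1.20)-(1.22) p.264 and (5.10) p.293; Balaban1988RG2Cluster, Lemma 3 (2.38) p.20] -/
theorem runRemAtSomeJetsK_of_runChain190K
    (h : ∀ (F : T4Family) (θ : Node00.Stage13HParams F 2) (hP : θ.Provisos₁₃SepCoPH F 2),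
      (θ.ZhUnity F 2 ∧ θ.SlotsNondegenerate₁₃ F 2) → θ.Admissible F 2 →
      B16.EndStatementBPrinted (Node00.datumOfRecord₁₃SepCoPH F 2 θ hP).C →
      (∃ γ₁ : ℝ, 0 < γ₁ ∧ ∀ γ : ℝ, 0 < γ → γ ≤ γ₁ →
        ∃ P : B12.RunParams, 1 ≤ P.K ∧ ((Node00.datumOfRecord₁₃SepCoPH F 2 θ hP).C P).flow.InInterval γ P.K) →
      ∃ (κ : StepColourData) (M : ℕ) (_ : NeZero M) (μ ν : Fin 4) (c : B13.Consts) (ℓ α₂ : ℝ) (q : Consts190) (γ₀ : ℝ),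
        (∀ (n : ℕ) (gs : ℕ → ℝ), RGEqH n (Node00.datumOfRecord₁₃SepCoPH F 2 θ hP).βfun gs → Step.InInterval γ₀ n gs → ∀ k, k ≤ n →
          ∃ a : LDom 4 → Pt 4 → ℝ, (Node00.datumOfRecord₁₃SepCoPH F 2 θ hP).βfun k (prefixOf gs k) - θ.cβ * beta0OfJs F κ k =
            B12Beta.secondMoment (fun _ _ => limKernel a) μ ν ∧ Nonempty (PolLeavesTFac190H 4 M a c ℓ α₂ q)) ∧
        CondsL 4 c ℓ ∧ c.R22gen ℓ ∧ q.Valid c.δ₀ ∧ SignsL c α₂ q.B₃ ∧ 0 < γ₀ ∧ γ₀ ≤ θ.γ ∧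
        c.ε₁ * remCoeffL 4 M c α₂ q.B₃ ≤ θ.cβ * B12Normalization.stepBal 2 F.L ∧
        ScaleAnchor (Node00.datumOfRecord₁₃SepCoPH F 2 θ hP).βfun (fun k => θ.cβ * beta0OfJs F κ k) ∧
        SurvCont (Node00.datumOfRecord₁₃SepCoPH F 2 θ hP).βfun γ₀) :
    ∀ (F : T4Family) (θ : Node00.Stage13HParams F 2) (hP : θ.Provisos₁₃SepCoPH F 2),
      (θ.ZhUnity F 2 ∧ θ.SlotsNondegenerate₁₃ F 2) → θ.Admissible F 2 →
      B16.EndStatementBPrinted (Node00.datumOfRecord₁₃SepCoPH F 2 θ hP).C →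
      (∃ γ₁ : ℝ, 0 < γ₁ ∧ ∀ γ : ℝ, 0 < γ → γ ≤ γ₁ →
        ∃ P : B12.RunParams, 1 ≤ P.K ∧ ((Node00.datumOfRecord₁₃SepCoPH F 2 θ hP).C P).flow.InInterval γ P.K) →
      ∃ κ : StepColourData, RunRemAt F κ θ hP θ.cβ := by
  intro F θ hP hU hθ hB hwin
  obtain ⟨κ, M, instM, μ, ν, c, ℓ, α₂, q, γ₀, hrun, hC, h22, hq, hs, hγ₀, hγθ, hcap, hA, hcont⟩ := h F θ hP hU hθ hB hwin
  exact ⟨κ, runRemAt_of_runLeaves190H F κ θ hP hrun hC h22 hq hs hγ₀ hγθ hcap hA hcont⟩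

/-- **★★ PRINT's ROAD + v6's (D1) STUB 1ᴬ `D1AtAnchoredJets` (VERBATIM, `Window13` unfolded) ⟹ THE CRUX DECL BY NAME** — `runRemAtSomeJetsK_of_runChain190K` then DEF-1's tree
concluder `EndpointGivenBR13SepCoPH_of_anchorKeyedK_runShadowingJetsK` (= v6's `EndpointGivenBR13SepCoPH_of_anchoredJetsRun`).  CONDITIONAL on both texts; K2⁷ NOT closed;
instance 0∕1. [cite: Balaban1987RG1, Thm 2 p.259 (first sentence), (1.3) p.260 and (5.10) p.293] -/
theorem EndpointGivenBR13SepCoPH_of_d1AnchoredK_runChain190K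
    (hD1 : ∀ (F : T4Family) (κ : StepColourData) (θ : Node00.Stage13HParams F 2) (hP : θ.Provisos₁₃SepCoPH F 2),
      (θ.ZhUnity F 2 ∧ θ.SlotsNondegenerate₁₃ F 2) → θ.Admissible F 2 →
      B16.EndStatementBPrinted (Node00.datumOfRecord₁₃SepCoPH F 2 θ hP).C →
      (∃ γ₁ : ℝ, 0 < γ₁ ∧ ∀ γ : ℝ, 0 < γ → γ ≤ γ₁ →
        ∃ P : B12.RunParams, 1 ≤ P.K ∧ ((Node00.datumOfRecord₁₃SepCoPH F 2 θ hP).C P).flow.InInterval γ P.K) →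
      ScaleAnchor (Node00.datumOfRecord₁₃SepCoPH F 2 θ hP).βfun (fun k => θ.cβ * beta0OfJs F κ k) →
      ∃ A : ℝ, OneLoopDrift (B12Normalization.stepBal 2 F.L) A (beta0OfJs F κ))
    (h : ∀ (F : T4Family) (θ : Node00.Stage13HParams F 2) (hP : θ.Provisos₁₃SepCoPH F 2),
      (θ.ZhUnity F 2 ∧ θ.SlotsNondegenerate₁₃ F 2) → θ.Admissible F 2 →
      B16.EndStatementBPrinted (Node00.datumOfRecord₁₃SepCoPH F 2 θ hP).C →
      (∃ γ₁ : ℝ, 0 < γ₁ ∧ ∀ γ : ℝ, 0 < γ → γ ≤ γ₁ →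
        ∃ P : B12.RunParams, 1 ≤ P.K ∧ ((Node00.datumOfRecord₁₃SepCoPH F 2 θ hP).C P).flow.InInterval γ P.K) →
      ∃ (κ : StepColourData) (M : ℕ) (_ : NeZero M) (μ ν : Fin 4) (c : B13.Consts) (ℓ α₂ : ℝ) (q : Consts190) (γ₀ : ℝ),
        (∀ (n : ℕ) (gs : ℕ → ℝ), RGEqH n (Node00.datumOfRecord₁₃SepCoPH F 2 θ hP).βfun gs → Step.InInterval γ₀ n gs → ∀ k, k ≤ n →
          ∃ a : LDom 4 → Pt 4 → ℝ, (Node00.datumOfRecord₁₃SepCoPH F 2 θ hP).βfun k (prefixOf gs k) - θ.cβ * beta0OfJs F κ k =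
            B12Beta.secondMoment (fun _ _ => limKernel a) μ ν ∧ Nonempty (PolLeavesTFac190H 4 M a c ℓ α₂ q)) ∧
        CondsL 4 c ℓ ∧ c.R22gen ℓ ∧ q.Valid c.δ₀ ∧ SignsL c α₂ q.B₃ ∧ 0 < γ₀ ∧ γ₀ ≤ θ.γ ∧
        c.ε₁ * remCoeffL 4 M c α₂ q.B₃ ≤ θ.cβ * B12Normalization.stepBal 2 F.L ∧
        ScaleAnchor (Node00.datumOfRecord₁₃SepCoPH F 2 θ hP).βfun (fun k => θ.cβ * beta0OfJs F κ k) ∧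
        SurvCont (Node00.datumOfRecord₁₃SepCoPH F 2 θ hP).βfun γ₀) :
    Summit.QuantumFields.YangMills.Theses.BalabanUVNodes.EndpointGivenBR13SepCoPH :=
  EndpointGivenBR13SepCoPH_of_anchorKeyedK_runShadowingJetsK hD1 (runRemAtSomeJetsK_of_runChain190K h)

end Keyed

end Summit.QuantumFields.YangMills.Theorems.BalabanUVNodesK2RunRemAtOfChain190

end
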